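import Summits.BirchSwinnertonDyer.BirchSwinnertonDyer.Theses.KatoDescentTamePotSupersingular
import Summits.BirchSwinnertonDyer.BirchSwinnertonDyer.Theorems.KatoDescentPotSupersingularMemberHullZetaCoreInputsOfKummer
import Summits.BirchSwinnertonDyer.BirchSwinnertonDyer.Theorems.KatoDescentPotSupersingularReducibleKatoMemberZetaInputsDescent
import HarnessLib

/-!
# Route `KatoDescentTamePotSupersingular` (rung K8-t′, cell `bsd-potss`): the shared crux M `ReducibleKatoMember`
# (item stmt-BirchSwinnertonDyer-19196) from the PRINT-EXACT held inputs — modularity, Kato's core member package with the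
# zeta-line index in KUMMER form `Kato2004.exists_memberHullZetaKummerCoreInputs`, the Poitou–Tate duality fact and
# Gross–Zagier–Kolyvagin — typed closer (seat `bsd-potss-rkm` g22)

WHAT.  `tameReducibleKatoMember_of_newformZ_of_kummerCoreInputs : PublishedInputNewformKatoZ → exists_memberHullZetaKummerCoreInputs →
poitouTate_selmerStructure_duality ℚ → PublishedInputRankEqAnalyticRankZ → ReducibleKatoMember` (the gen-4 alias names of the K8-t′ route) — the glue term for a gen-4 resplit of
crux M on K8-t′ keyed to the print-exact package.  Proof: the Kummer-form fact gives the core fact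
and the zeta fact (`MemberHullZetaCoreInputsOfKummer.exists_memberHullZetaInputs_of_kummerCoreInputs`: the bridge of parts 63–64, then seat rkm
g21's `exists_memberHullZetaInputs_of_coreInputs`), then rkm g13's route-free node `ZetaInputsDescent.katoMemberShaBoundOfReducible_of_newform_of_zetaInputs`.  HONEST FRAMING: conditional on the four named facts (cite-level published
inputs, no `_holds` expected); the item is NOT closed by this file; nothing is booked; BSD is not advanced.

References: K. Kato, Astérisque 295 (2004), Thm. 12.5/12.6, Lemma 13.10 (1), Thm. 14.5 (2), (14.9.3), (14.14.1)–(14.14.2), Prop. 14.16 (2),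
Lemma 14.18 [Kato2004Asterisque]; C.-H. Kim, AJM 148 §3.2.3 [Kim2022StructureSelmer]; J. S. Milne, *ADT* I Cor. 3.4, Thm. 4.10
[MilneADT2006]; H. Darmon, CBMS 101 Thm. 3.22 [Darmon2004].
-/

set_option autoImplicit false
-- sibling precedent: the directory name repeats the summit name
set_option linter.dupNamespace false

noncomputable section

namespace Summit.BirchSwinnertonDyer.BirchSwinnertonDyer.Theorems

open Literature.NumberTheory.EllipticCurves Literature.NumberTheory.EllipticCurves.ModularForms
  Literature.NumberTheory.EllipticCurves.Kato2004 Literature.NumberTheory.GaloisCohomology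
open Summit.BirchSwinnertonDyer.BirchSwinnertonDyer.Theses.KatoDescentTamePotSupersingular

/-- **The K8-t′ crux `ReducibleKatoMember` (item stmt-BirchSwinnertonDyer-19196; conclusion = the route decl by name) from the
PRINT-EXACT held inputs**: `PublishedInputNewformKatoZ → Kato2004.exists_memberHullZetaKummerCoreInputs →
poitouTate_selmerStructure_duality ℚ → PublishedInputRankEqAnalyticRankZ → ReducibleKatoMember` (modularity; Kato's core member
package with (b′) the zeta-line index at `p` as the printed EQUALITY in Kummer form and (c2′) the order of `𝐇²/X𝐇²`; Poitou–Tate;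
Gross–Zagier–Kolyvagin).  The aliases unfold by `rfl`.  Conditional on the four named facts; the item is not closed by this theorem.
[cite: Kato2004Asterisque, Thm. 14.5 (2) (p. 236), (14.9.3) (p. 240), (14.14.2) (p. 243), Prop. 14.16 (2) (pp. 244–245), Lemma 14.18 (pp. 247–248)]
[cite: Kim2022StructureSelmer, §3.2.3] [cite: MilneADT2006, Ch. I, Cor. 3.4 and Thm. 4.10 (b)] [cite: Darmon2004, Thm. 3.22] -/
theorem tameReducibleKatoMember_of_newformZ_of_kummerCoreInputs (hN : PublishedInputNewformKatoZ)
    (hK : Kato2004.exists_memberHullZetaKummerCoreInputs) (hPT : poitouTate_selmerStructure_duality ℚ)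
    (hG : PublishedInputRankEqAnalyticRankZ) :
    Summit.BirchSwinnertonDyer.BirchSwinnertonDyer.Theses.KatoDescentTamePotSupersingular.ReducibleKatoMember :=
  ZetaInputsDescent.katoMemberShaBoundOfReducible_of_newform_of_zetaInputs hN
    (MemberHullZetaCoreInputsOfKummer.exists_memberHullZetaInputs_of_kummerCoreInputs hG hPT hK)

end Summit.BirchSwinnertonDyer.BirchSwinnertonDyer.Theorems

end
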